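import Summits.AtomisticToContinuum.BoseEinsteinCondensation.Theorems.PeriodicIRBound.Negative.HardCoreScope
import HarnessLib

/-!
# Route `BECGroundStateSOS`, crux `PeriodicIRBound` (stmt-AtomisticToContinuum-3972) — GLUE of the recommended split
# `PeriodicIRBound ⟸ IntegrablePeriodicIRBound ∧ NonIntegrablePeriodicIRBound` (lead c23, 2026-08-17)

After SOFT-LOCATION (crux dir) and the landed `Theorems/…TwoSectorEquivalence.lean` (`PeriodicIRBound ↔ S1₁ ∧ S6` with
`S1₁ ↔ X_int`), the honest split of the crux is by integrability class. Both children are written over Literature vocabulary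
(the crux body with the scope hypothesis added); the glue is the landed `Negative.periodicIRBound_iff_split` (HardCoreScope,
Disproof §19) — usable as `--glue-by`. Children texts: evidence `children-halves.json`.
-/

namespace Summit.AtomisticToContinuum.BoseEinsteinCondensation.Theorems.BECGroundStateSOSPeriodicIRBoundSplitHalves

open Summit.AtomisticToContinuum.BoseEinsteinCondensation.Theses.BECGroundStateSOS (PeriodicIRBound)
open Summit.AtomisticToContinuum.BoseEinsteinCondensation.Theorems.PeriodicIRBound.Negative (IRBoundFor periodicIRBound_iff_split)

/-- Child 1 (X_int, unfolded) ↔ the integrable half: definitional. [folklore] -/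
theorem integrablePeriodicIRBound_iff :
    (∀ v : ℝ → ENNReal, Literature.MathematicalPhysics.QuantumManyBody.BoseGas.IsRepulsiveFiniteRange v → (∫⁻ x : EuclideanSpace ℝ (Fin 3), v ‖x‖) ≠ ⊤ → ∀ κ : ℝ, 0 < κ → ∃ ρ₀ : ℝ, 0 < ρ₀ ∧ ∃ C : ℝ, 0 < C ∧ ∀ ρ : ℝ, 0 < ρ → ρ < ρ₀ → ∀ᶠ N : ℕ in Filter.atTop, let L : ℝ := Literature.MathematicalPhysics.QuantumManyBody.BoseGas.sideLength ρ N; ∃ δ : ENNReal, 0 < δ ∧ ∀ Ψ : Literature.MathematicalPhysics.QuantumManyBody.BoseGas.PeriodicTrialState N L, Literature.MathematicalPhysics.QuantumManyBody.BoseGas.periodicEnergy v Ψ ≤ Literature.MathematicalPhysics.QuantumManyBody.BoseGas.periodicGroundStateEnergy v N L + δ → ∀ k : Fin 3 → ℤ, (k ≠ 0 ∧ ‖(fun j => (k j : ℝ))‖ ≤ κ * Real.sqrt ρ * L) → Literature.MathematicalPhysics.QuantumManyBody.BoseGas.cellOccupation N L (fun x => ((Real.sqrt (L ^ 3))⁻¹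 : ℂ) * Literature.MathematicalPhysics.QuantumManyBody.BoseGas.cellWave L k x) Ψ.ψ ≤ ENNReal.ofReal (C * Real.sqrt ρ * L / ‖(fun j => (k j : ℝ))‖)) ↔
      ∀ v, Literature.MathematicalPhysics.QuantumManyBody.BoseGas.IsRepulsiveFiniteRange v →
        (∫⁻ x : EuclideanSpace ℝ (Fin 3), v ‖x‖) ≠ ⊤ → IRBoundFor v :=
  Iff.rfl

/-- Child 2 (X_hc, unfolded) ↔ the non-integrable half: definitional. [folklore] -/
theorem nonIntegrablePeriodicIRBound_iff' :
    (∀ v : ℝ → ENNReal, Literature.MathematicalPhysics.QuantumManyBody.BoseGas.IsRepulsiveFiniteRange v → (∫⁻ x : EuclideanSpace ℝ (Fin 3), v ‖x‖) = ⊤ → ∀ κ : ℝ, 0 < κ → ∃ ρ₀ : ℝ, 0 < ρ₀ ∧ ∃ C : ℝ, 0 < C ∧ ∀ ρ : ℝ, 0 < ρ → ρ < ρ₀ → ∀ᶠ N : ℕ in Filter.atTop, let L : ℝ := Literature.MathematicalPhysics.QuantumManyBody.BoseGas.sideLength ρ N; ∃ δ : ENNReal, 0 < δ ∧ ∀ Ψ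 : Literature.MathematicalPhysics.QuantumManyBody.BoseGas.PeriodicTrialState N L, Literature.MathematicalPhysics.QuantumManyBody.BoseGas.periodicEnergy v Ψ ≤ Literature.MathematicalPhysics.QuantumManyBody.BoseGas.periodicGroundStateEnergy v N L + δ → ∀ k : Fin 3 → ℤ, (k ≠ 0 ∧ ‖(fun j => (k j : ℝ))‖ ≤ κ * Real.sqrt ρ * L) → Literature.MathematicalPhysics.QuantumManyBody.BoseGas.cellOccupation N L (fun x => ((Real.sqrt (L ^ 3))⁻¹ : ℂ) * Literature.MathematicalPhysics.QuantumManyBody.BoseGas.cellWave L k x) Ψ.ψ ≤ ENNReal.ofReal (C * Real.sqrt ρ * L / ‖(fun j => (k j : ℝ))‖)) ↔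
      ∀ v, Literature.MathematicalPhysics.QuantumManyBody.BoseGas.IsRepulsiveFiniteRange v →
        (∫⁻ x : EuclideanSpace ℝ (Fin 3), v ‖x‖) = ⊤ → IRBoundFor v :=
  Iff.rfl

/-- **GLUE**: the two halves give the crux by name (landed `Negative.periodicIRBound_iff_split`). [folklore] -/
theorem PeriodicIRBound_of_halves :
    (∀ v : ℝ → ENNReal, Literature.MathematicalPhysics.QuantumManyBody.BoseGas.IsRepulsiveFiniteRange v → (∫⁻ x : EuclideanSpace ℝ (Fin 3), v ‖x‖) ≠ ⊤ → ∀ κ : ℝ, 0 < κ → ∃ ρ₀ : ℝ, 0 < ρ₀ ∧ ∃ C : ℝ, 0 < C ∧ ∀ ρ : ℝ, 0 < ρ → ρ < ρ₀ → ∀ᶠ N : ℕ in Filter.atTop, let L : ℝ := Literature.MathematicalPhysics.QuantumManyBody.BoseGas.sideLength ρ N; ∃ δ : ENNReal, 0 < δ ∧ ∀ Ψ : Literature.MathematicalPhysics.QuantumManyBody.BoseGas.PeriodicTrialState N L, Literature.MathematicalPhysics.QuantumManyBody.BoseGas.periodicEnergy v Ψ ≤ Literature.MathematicalPhysics.QuantumManyBody.BoseGas.periodicGroundStateEnergy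 v N L + δ → ∀ k : Fin 3 → ℤ, (k ≠ 0 ∧ ‖(fun j => (k j : ℝ))‖ ≤ κ * Real.sqrt ρ * L) → Literature.MathematicalPhysics.QuantumManyBody.BoseGas.cellOccupation N L (fun x => ((Real.sqrt (L ^ 3))⁻¹ : ℂ) * Literature.MathematicalPhysics.QuantumManyBody.BoseGas.cellWave L k x) Ψ.ψ ≤ ENNReal.ofReal (C * Real.sqrt ρ * L / ‖(fun j => (k j : ℝ))‖)) →
    (∀ v : ℝ → ENNReal, Literature.MathematicalPhysics.QuantumManyBody.BoseGas.IsRepulsiveFiniteRange v → (∫⁻ x : EuclideanSpace ℝ (Fin 3), v ‖x‖) = ⊤ → ∀ κ : ℝ, 0 < κ → ∃ ρ₀ : ℝ, 0 < ρ₀ ∧ ∃ C : ℝ, 0 < C ∧ ∀ ρ : ℝ, 0 < ρ → ρ < ρ₀ → ∀ᶠ N : ℕ in Filter.atTop, let L : ℝ := Literature.MathematicalPhysics.QuantumManyBody.BoseGas.sideLength ρ N; ∃ δ : ENNReal, 0 < δ ∧ ∀ Ψ : Literature.MathematicalPhysics.QuantumManyBody.BoseGas.PeriodicTrialState N L, Literature.MathematicalPhysics.QuantumManyBody.BoseGas.periodicEnergy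 v Ψ ≤ Literature.MathematicalPhysics.QuantumManyBody.BoseGas.periodicGroundStateEnergy v N L + δ → ∀ k : Fin 3 → ℤ, (k ≠ 0 ∧ ‖(fun j => (k j : ℝ))‖ ≤ κ * Real.sqrt ρ * L) → Literature.MathematicalPhysics.QuantumManyBody.BoseGas.cellOccupation N L (fun x => ((Real.sqrt (L ^ 3))⁻¹ : ℂ) * Literature.MathematicalPhysics.QuantumManyBody.BoseGas.cellWave L k x) Ψ.ψ ≤ ENNReal.ofReal (C * Real.sqrt ρ * L / ‖(fun j => (k j : ℝ))‖)) →
    PeriodicIRBound :=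
  fun h1 h2 => periodicIRBound_iff_split.2 ⟨h1, h2⟩

/-- **And conversely** (the split loses nothing). [folklore] -/
theorem halves_of_PeriodicIRBound (h : PeriodicIRBound) :
    (∀ v : ℝ → ENNReal, Literature.MathematicalPhysics.QuantumManyBody.BoseGas.IsRepulsiveFiniteRange v → (∫⁻ x : EuclideanSpace ℝ (Fin 3), v ‖x‖) ≠ ⊤ → ∀ κ : ℝ, 0 < κ → ∃ ρ₀ : ℝ, 0 < ρ₀ ∧ ∃ C : ℝ, 0 < C ∧ ∀ ρ : ℝ, 0 < ρ → ρ < ρ₀ → ∀ᶠ N : ℕ in Filter.atTop, let L : ℝ := Literature.MathematicalPhysics.QuantumManyBody.BoseGas.sideLength ρ N; ∃ δ : ENNReal, 0 < δ ∧ ∀ Ψ : Literature.MathematicalPhysics.QuantumManyBody.BoseGas.PeriodicTrialState N L, Literature.MathematicalPhysics.QuantumManyBody.BoseGas.periodicEnergy v Ψ ≤ Literature.MathematicalPhysics.QuantumManyBody.BoseGas.periodicGroundStateEnergy v N L + δ → ∀ k : Fin 3 → ℤ, (k ≠ 0 ∧ ‖(fun j => (k j : ℝ))‖ ≤ κ *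 Real.sqrt ρ * L) → Literature.MathematicalPhysics.QuantumManyBody.BoseGas.cellOccupation N L (fun x => ((Real.sqrt (L ^ 3))⁻¹ : ℂ) * Literature.MathematicalPhysics.QuantumManyBody.BoseGas.cellWave L k x) Ψ.ψ ≤ ENNReal.ofReal (C * Real.sqrt ρ * L / ‖(fun j => (k j : ℝ))‖)) ∧ (∀ v : ℝ → ENNReal, Literature.MathematicalPhysics.QuantumManyBody.BoseGas.IsRepulsiveFiniteRange v → (∫⁻ x : EuclideanSpace ℝ (Fin 3), v ‖x‖) = ⊤ → ∀ κ : ℝ, 0 < κ → ∃ ρ₀ : ℝ, 0 < ρ₀ ∧ ∃ C : ℝ, 0 < C ∧ ∀ ρ : ℝ, 0 < ρ → ρ < ρ₀ → ∀ᶠ N : ℕ in Filter.atTop, let L : ℝ := Literature.MathematicalPhysics.QuantumManyBody.BoseGas.sideLength ρ N; ∃ δ : ENNReal, 0 < δ ∧ ∀ Ψ : Literature.MathematicalPhysics.QuantumManyBody.BoseGas.PeriodicTrialState N L, Literature.MathematicalPhysics.QuantumManyBody.BoseGas.periodicEnergy v Ψ ≤ Literature.MathematicalPhysics.QuantumManyBody.BoseGas.periodicGroundStateEnergy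 v N L + δ → ∀ k : Fin 3 → ℤ, (k ≠ 0 ∧ ‖(fun j => (k j : ℝ))‖ ≤ κ * Real.sqrt ρ * L) → Literature.MathematicalPhysics.QuantumManyBody.BoseGas.cellOccupation N L (fun x => ((Real.sqrt (L ^ 3))⁻¹ : ℂ) * Literature.MathematicalPhysics.QuantumManyBody.BoseGas.cellWave L k x) Ψ.ψ ≤ ENNReal.ofReal (C * Real.sqrt ρ * L / ‖(fun j => (k j : ℝ))‖)) :=
  periodicIRBound_iff_split.1 h

end Summit.AtomisticToContinuum.BoseEinsteinCondensation.Theorems.BECGroundStateSOSPeriodicIRBoundSplitHalves
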